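import Summits.RiemannHypothesis.RiemannHypothesis.Theorems.PfPersistenceAdmissibleClass
import HarnessLib

/-!
# PF persistence — the CENTRAL-MASS FLOOR of a one-signed profile (pub-rhpf theory-4; helper)

**HONEST FRAMING. Mechanism / rigidity campaign; no RH claims.** Pure finite-dimensional analysis, RH-free.

Setting: the typer's Galerkin layer `Theorems/PfPersistenceAdmissibleClass.lean` — Connes' even cosine modes
`xiEven L n` on the window `[-L/2, L/2]` (`L = 2a`), the PROFILE `profile L v = Σ_n v_n ξ_n` of a coefficient
vector `v : Fin (N+1) → ℝ`, and the primitive `OneSigned L v` (the profile keeps one sign on the window; the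
`T1` shadow S3-I1 of the cell's gap-class ledger).

The CENTRAL MASS of `v` (observatory field `|u_even[0]|·√(2a)` for a unit vector; STRUCTURE-D3 §D2, gap row
S3-I6, CASE-DAG leaf G1.12) is `m(v) = |v 0| √L / ‖v‖ = |∫_{-L/2}^{L/2} θ_v| / ‖θ_v‖_{L²}`: only the constant
mode has non-zero mean on the window and the modes are orthonormal.

**PROVED here (kernel-lemma target `CentralMassFloor`, ADJ-LOG RULING A5 (iii), CASE-DAG §6):**
* `integral_xiEven_mul_xiEven` — the modes are ORTHONORMAL on the window; `integral_profile_sq` — Parseval at lag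
  zero, `∫ θ_v² = v ⬝ᵥ v`; `integral_profile` — `∫ θ_v = v 0 · √L`;
* `profile_sq_le` — the pointwise (sup-norm) bound `θ_v(x)² ≤ (v ⬝ᵥ v)(2N+1)/L`;
* `dotProduct_self_le_of_oneSigned` — **the floor**: `OneSigned L v → v ⬝ᵥ v ≤ (2N+1)·(v 0)²`, i.e. a one-signed
  profile keeps at least the fraction `1/(2N+1)` of its `ℓ²` mass on the constant mode
  (`‖θ‖₂² ≤ ‖θ‖_∞ ‖θ‖₁ = ‖θ‖_∞ · v₀√L` and `‖θ‖_∞ ≤ ‖v‖ √((2N+1)/L)`);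
* `centralMass_floor` — `√(L/(2N+1)) ≤ m(v)` for `v ≠ 0` one-signed, and the cell's form
  `centralMass_floor_halfWidth`: `√a/√(N+1) ≤ m(v)` at half-width `a` (`L = 2a`; `√(2a/(2N+1)) ≥ √(a/(N+1))`);
* `not_oneSigned_of_centralMass_lt` — contrapositive (failure class F3: a bottom vector whose central mass is below
  the floor is NODAL).

What is NOT here: the DATA law `m ≈ C·ε₁` for families with a central zero (STRUCTURE-D3 §D2) — not a theorem; and
no statement about `ζ`.  Orthonormality at lag `0` is also a special case of fake-4's staged integral representation
of `thetaEven` (`autocorr_zero`); it is re-proved here directly so that this file depends on the typer's definitions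
only.  Decls live in the sub-namespace `…PfPersistence.CentralMassFloor` to avoid clashes with sibling helpers.
-/

set_option linter.dupNamespace false  -- the mandated namespace repeats `RiemannHypothesis`

noncomputable section

namespace Summit.RiemannHypothesis.RiemannHypothesis.Theorems.PfPersistence.CentralMassFloor

open Real intervalIntegral MeasureTheory Set Matrix Finset

/-! ## 1. The modes: continuity, pointwise bound, window integrals -/

/-- PROVED: the modes are continuous. [folklore] -/
@[fun_prop]
theorem continuous_xiEven (L : ℝ) (n : ℕ) : Continuous (fun x => xiEven L n x) := by
  by_cases hn : n = 0
  · simp only [xiEven, hn, if_true]; exact continuous_const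
  · simp only [xiEven, hn, if_false]; fun_prop

/-- PROVED: profiles are continuous. [folklore] -/
@[fun_prop]
theorem continuous_profile (L : ℝ) {N : ℕ} (v : Fin (N + 1) → ℝ) : Continuous (fun x => profile L v x) := by
  unfold profile; fun_prop

/-- PROVED: pointwise bound on the squared modes: `ξ₀² = 1/L`, `ξ_n² ≤ 2/L` (`n ≥ 1`), for `0 < L`. [folklore] -/
theorem xiEven_sq_le {L : ℝ} (hL : 0 < L) (n : ℕ) (x : ℝ) :
    xiEven L n x ^ 2 ≤ if n = 0 then 1 / L else 2 / L := by
  by_cases hn : n = 0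
  · simp only [xiEven, hn, if_true]
    rw [div_pow, one_pow, Real.sq_sqrt hL.le]
  · simp only [xiEven, hn, if_false]
    have h1 : ((-1 : ℝ) ^ n) ^ 2 = 1 := by
      rw [← pow_mul, mul_comm, pow_mul, neg_one_sq, one_pow]
    have h2 : Real.sqrt (2 / L) ^ 2 = 2 / L := Real.sq_sqrt (by positivity)
    have hc : Real.cos (2 * π * n * x / L) ^ 2 ≤ 1 := by
      rw [sq_le_one_iff_abs_le_one]; exact Real.abs_cos_le_one _
    have h2L : 0 ≤ 2 / L := by positivity
    calc ((-1 : ℝ) ^ n * Real.sqrt (2 / L) * Real.cos (2 * π * n * x / L)) ^ 2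
        = ((-1 : ℝ) ^ n) ^ 2 * Real.sqrt (2 / L) ^ 2 * Real.cos (2 * π * n * x / L) ^ 2 := by ring
      _ = 2 / L * Real.cos (2 * π * n * x / L) ^ 2 := by rw [h1, h2, one_mul]
      _ ≤ 2 / L * 1 := by gcongr
      _ = 2 / L := mul_one _

/-- PROVED: `Σ_{n ≤ N} ξ_n(x)² ≤ (2N+1)/L` for `0 < L`. [folklore] -/
theorem sum_xiEven_sq_le {L : ℝ} (hL : 0 < L) (N : ℕ) (x : ℝ) :
    ∑ n : Fin (N + 1), xiEven L n x ^ 2 ≤ (2 * N + 1) / L := by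
  calc ∑ n : Fin (N + 1), xiEven L n x ^ 2
      ≤ ∑ n : Fin (N + 1), (if (n : ℕ) = 0 then 1 / L else 2 / L) :=
        Finset.sum_le_sum fun n _ => xiEven_sq_le hL n x
    _ = 1 / L + ∑ _n : Fin N, 2 / L := by
        rw [Fin.sum_univ_succ]
        simp only [Fin.val_zero, if_true, Fin.val_succ, Nat.succ_ne_zero, if_false]
    _ = (2 * N + 1) / L := by
        rw [Finset.sum_const, Finset.card_univ, Fintype.card_fin, nsmul_eq_mul]
        field_simp
        ring

/-- PROVED (Cauchy–Schwarz): the pointwise bound `θ_v(x)² ≤ (v ⬝ᵥ v) · (2N+1)/L` for `0 < L`. [folklore] -/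
theorem profile_sq_le {L : ℝ} (hL : 0 < L) {N : ℕ} (v : Fin (N + 1) → ℝ) (x : ℝ) :
    profile L v x ^ 2 ≤ (v ⬝ᵥ v) * ((2 * N + 1) / L) := by
  unfold profile
  have hvv : v ⬝ᵥ v = ∑ n : Fin (N + 1), v n ^ 2 := by
    simp only [dotProduct, sq]
  calc (∑ n : Fin (N + 1), v n * xiEven L n x) ^ 2
      ≤ (∑ n : Fin (N + 1), v n ^ 2) * ∑ n : Fin (N + 1), xiEven L n x ^ 2 :=
        Finset.sum_mul_sq_le_sq_mul_sq _ _ _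
    _ ≤ (∑ n : Fin (N + 1), v n ^ 2) * ((2 * N + 1) / L) :=
        mul_le_mul_of_nonneg_left (sum_xiEven_sq_le hL N x) (Finset.sum_nonneg fun n _ => sq_nonneg _)
    _ = (v ⬝ᵥ v) * ((2 * N + 1) / L) := by rw [hvv]

/-- PROVED: `∫_{-L/2}^{L/2} cos(c x) dx = 0` whenever `c ≠ 0` and `c · L/2` is an integer multiple of `π`. [folklore] -/
theorem integral_cos_mul_window {L c : ℝ} (hc : c ≠ 0) (j : ℤ) (hj : c * (L / 2) = j * π) :
    ∫ x in (-(L / 2))..(L / 2), Real.cos (c * x) = 0 := by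
  have h1 : Real.sin (c * (L / 2)) = 0 := by rw [hj]; exact Real.sin_int_mul_pi j
  have h2 : Real.sin (c * (-(L / 2))) = 0 := by rw [mul_neg, Real.sin_neg, h1, neg_zero]
  rw [intervalIntegral.integral_comp_mul_left (fun θ => Real.cos θ) hc, integral_cos, h1, h2]
  simp

/-- PROVED: `∫_{-L/2}^{L/2} cos(2π k x / L) dx = 0` for a natural number `k ≠ 0` and `0 < L`. [folklore] -/
theorem integral_cos_mode_window {L : ℝ} (hL : 0 < L) {k : ℕ} (hk : k ≠ 0) :
    ∫ x in (-(L / 2))..(L / 2), Real.cos (2 * π * k * x / L) = 0 := by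
  have hc : (2 * π * k / L : ℝ) ≠ 0 := by
    have : (0 : ℝ) < 2 * π * k / L := by
      have hk' : (0 : ℝ) < k := by exact_mod_cast Nat.pos_of_ne_zero hk
      positivity
    exact this.ne'
  have hfun : (fun x => Real.cos (2 * π * k * x / L)) = fun x => Real.cos (2 * π * k / L * x) := by
    funext x; congr 1; ring
  rw [hfun]
  refine integral_cos_mul_window hc (k : ℤ) ?_
  push_cast
  field_simp

/-- PROVED: the window integral of a mode: `∫ ξ₀ = √L`, `∫ ξ_n = 0` for `n ≥ 1` (`0 < L`). [folklore] -/
theorem integral_xiEven {L : ℝ} (hL : 0 < L) (n : ℕ) :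
    ∫ x in (-(L / 2))..(L / 2), xiEven L n x = if n = 0 then Real.sqrt L else 0 := by
  by_cases hn : n = 0
  · simp only [xiEven, hn, if_true, intervalIntegral.integral_const, smul_eq_mul]
    have hL' : Real.sqrt L ≠ 0 := (Real.sqrt_pos.2 hL).ne'
    have hLL : Real.sqrt L * Real.sqrt L = L := Real.mul_self_sqrt hL.le
    field_simp
    nlinarith [hLL]
  · simp only [xiEven, hn, if_false]
    rw [intervalIntegral.integral_const_mul, integral_cos_mode_window hL hn, mul_zero]

/-- PROVED: `∫_{-L/2}^{L/2} θ_v = v 0 · √L` — only the constant mode has a mean. [folklore] -/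
theorem integral_profile {L : ℝ} (hL : 0 < L) {N : ℕ} (v : Fin (N + 1) → ℝ) :
    ∫ x in (-(L / 2))..(L / 2), profile L v x = v 0 * Real.sqrt L := by
  unfold profile
  rw [intervalIntegral.integral_finsetSum (fun n _ => Continuous.intervalIntegrable (by fun_prop) _ _)]
  simp_rw [intervalIntegral.integral_const_mul, integral_xiEven hL]
  rw [Fin.sum_univ_succ]
  simp only [Fin.val_zero, if_true, Fin.val_succ, Nat.succ_ne_zero, if_false, mul_zero, Finset.sum_const_zero,
    add_zero]

/-- PROVED: the modes are ORTHONORMAL on the window: `∫_{-L/2}^{L/2} ξ_n ξ_m = δ_{nm}` (`0 < L`). [folklore] -/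
theorem integral_xiEven_mul_xiEven {L : ℝ} (hL : 0 < L) (n m : ℕ) :
    ∫ x in (-(L / 2))..(L / 2), xiEven L n x * xiEven L m x = if n = m then 1 else 0 := by
  have hLne : L ≠ 0 := hL.ne'
  -- product-to-sum, inlined (the named identity lives in `Literature` already; not re-declared here)
  have hcc : ∀ p q : ℝ, Real.cos p * Real.cos q = (Real.cos (p - q) + Real.cos (p + q)) / 2 :=
    fun p q => by rw [Real.cos_sub, Real.cos_add]; ring
  by_cases hn : n = 0
  · subst hn
    by_cases hm : m = 0
    · subst hm
      simp only [xiEven, if_true, intervalIntegral.integral_const, smul_eq_mul]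
      have hLL : Real.sqrt L * Real.sqrt L = L := Real.mul_self_sqrt hL.le
      have hL' : Real.sqrt L ≠ 0 := (Real.sqrt_pos.2 hL).ne'
      field_simp
      nlinarith [hLL]
    · have h0 : (0 : ℕ) ≠ m := fun h => hm h.symm
      simp only [h0, if_false]
      have : (fun x => xiEven L 0 x * xiEven L m x) = fun x => (1 / Real.sqrt L) * xiEven L m x := by
        funext x; simp only [xiEven, if_true]
      rw [this, intervalIntegral.integral_const_mul, integral_xiEven hL m]
      simp [hm]
  · by_cases hm : m = 0
    · subst hm
      simp only [hn, if_false]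
      have : (fun x => xiEven L n x * xiEven L 0 x) = fun x => (1 / Real.sqrt L) * xiEven L n x := by
        funext x; simp only [xiEven, if_true]; ring
      rw [this, intervalIntegral.integral_const_mul, integral_xiEven hL n]
      simp [hn]
    · -- both `n, m ≥ 1`: product-to-sum
      have hprod : (fun x => xiEven L n x * xiEven L m x) = fun x =>
          ((-1 : ℝ) ^ n * (-1 : ℝ) ^ m * (2 / L) / 2) *
            (Real.cos (2 * π * n * x / L - 2 * π * m * x / L)
              + Real.cos (2 * π * n * x / L + 2 * π * m * x / L)) := by
        funext x
        simp only [xiEven, hn, hm, if_false]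
        have h2 : Real.sqrt (2 / L) * Real.sqrt (2 / L) = 2 / L := Real.mul_self_sqrt (by positivity)
        rw [show (-1 : ℝ) ^ n * Real.sqrt (2 / L) * Real.cos (2 * π * n * x / L)
            * ((-1 : ℝ) ^ m * Real.sqrt (2 / L) * Real.cos (2 * π * m * x / L))
            = (-1 : ℝ) ^ n * (-1 : ℝ) ^ m * (Real.sqrt (2 / L) * Real.sqrt (2 / L))
              * (Real.cos (2 * π * n * x / L) * Real.cos (2 * π * m * x / L)) by ring, h2, hcc]
        ring
      rw [hprod, intervalIntegral.integral_const_mul,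
        intervalIntegral.integral_add (Continuous.intervalIntegrable (by fun_prop) _ _)
          (Continuous.intervalIntegrable (by fun_prop) _ _)]
      -- the sum frequency `n + m ≥ 1` integrates to zero
      have hsum : ∫ x in (-(L / 2))..(L / 2), Real.cos (2 * π * n * x / L + 2 * π * m * x / L) = 0 := by
        have hf : (fun x => Real.cos (2 * π * n * x / L + 2 * π * m * x / L))
            = fun x => Real.cos (2 * π * ((n + m : ℕ) : ℝ) * x / L) := by
          funext x; congr 1; push_cast; ring
        rw [hf]
        exact integral_cos_mode_window hL (by omega)
      rw [hsum, add_zero]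
      by_cases hnm : n = m
      · subst hnm
        simp only [if_true, sub_self, Real.cos_zero, intervalIntegral.integral_const, smul_eq_mul, mul_one]
        have h1 : (-1 : ℝ) ^ n * (-1 : ℝ) ^ n = 1 := by
          rw [← pow_add, ← two_mul, pow_mul, neg_one_sq, one_pow]
        rw [h1]
        field_simp
        ring
      · simp only [hnm, if_false]
        -- the difference frequency `n − m ≠ 0` integrates to zero
        have hdiff : ∫ x in (-(L / 2))..(L / 2), Real.cos (2 * π * n * x / L - 2 * π * m * x / L) = 0 := by
          have hc : (2 * π * ((n : ℝ) - m) / L) ≠ 0 := by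
            have hnm' : ((n : ℝ) - m) ≠ 0 := by
              rw [sub_ne_zero]; exact_mod_cast hnm
            have hπ : (2 * π : ℝ) ≠ 0 := by positivity
            exact div_ne_zero (mul_ne_zero hπ hnm') hLne
          have hf : (fun x => Real.cos (2 * π * n * x / L - 2 * π * m * x / L))
              = fun x => Real.cos (2 * π * ((n : ℝ) - m) / L * x) := by
            funext x; congr 1; ring
          rw [hf]
          refine integral_cos_mul_window hc ((n : ℤ) - m) ?_
          push_cast
          field_simp
        rw [hdiff, mul_zero]

/-- PROVED (Parseval at lag zero): `∫_{-L/2}^{L/2} θ_v² = v ⬝ᵥ v` for `0 < L`. [folklore] -/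
theorem integral_profile_sq {L : ℝ} (hL : 0 < L) {N : ℕ} (v : Fin (N + 1) → ℝ) :
    ∫ x in (-(L / 2))..(L / 2), profile L v x ^ 2 = v ⬝ᵥ v := by
  have hint : ∀ x, profile L v x ^ 2
      = ∑ n : Fin (N + 1), ∑ m : Fin (N + 1), v n * v m * (xiEven L n x * xiEven L m x) := by
    intro x; unfold profile; rw [sq, Finset.sum_mul_sum]
    exact Finset.sum_congr rfl fun n _ => Finset.sum_congr rfl fun m _ => by ring
  simp_rw [hint]
  rw [intervalIntegral.integral_finsetSum
    (f := fun (n : Fin (N + 1)) x => ∑ m : Fin (N + 1), v n * v m * (xiEven L n x * xiEven L m x))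
    (fun n _ => Continuous.intervalIntegrable (by fun_prop) _ _)]
  have hrow : ∀ n : Fin (N + 1),
      ∫ x in (-(L / 2))..(L / 2), ∑ m : Fin (N + 1), v n * v m * (xiEven L n x * xiEven L m x)
        = v n * v n := by
    intro n
    rw [intervalIntegral.integral_finsetSum
      (f := fun (m : Fin (N + 1)) x => v n * v m * (xiEven L n x * xiEven L m x))
      (fun m _ => Continuous.intervalIntegrable (by fun_prop) _ _)]
    simp_rw [intervalIntegral.integral_const_mul, integral_xiEven_mul_xiEven hL]
    simp only [Fin.val_inj, mul_ite, mul_one, mul_zero, Finset.sum_ite_eq, Finset.mem_univ, if_true]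
  simp_rw [hrow]
  simp only [dotProduct]

/-! ## 2. The floor -/

/-- PROVED: the squared length of a real vector is nonnegative. [folklore] -/
theorem dotProduct_self_nonneg {N : ℕ} (v : Fin (N + 1) → ℝ) : 0 ≤ v ⬝ᵥ v :=
  Finset.sum_nonneg fun i _ => mul_self_nonneg (v i)

/-- PROVED: profiles are linear in the sign of the coefficient vector: `θ_{-v} = -θ_v`. [folklore] -/
theorem profile_neg (L : ℝ) {N : ℕ} (v : Fin (N + 1) → ℝ) (x : ℝ) :
    profile L (-v) x = -profile L v x := by
  simp only [profile, Pi.neg_apply, neg_mul, Finset.sum_neg_distrib]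

/-- PROVED (the floor, nonnegative case): if `θ_v ≥ 0` on `[-L/2, L/2]` (`0 < L`) then
`v ⬝ᵥ v ≤ (2N+1) (v 0)²`. Proof: `v ⬝ᵥ v = ∫ θ_v² ≤ ‖θ_v‖_∞ ∫ θ_v = ‖θ_v‖_∞ · v₀ √L` and
`‖θ_v‖_∞ ≤ √(v ⬝ᵥ v) · √((2N+1)/L)`. [folklore] -/
theorem dotProduct_self_le_of_nonneg {L : ℝ} (hL : 0 < L) {N : ℕ} {v : Fin (N + 1) → ℝ}
    (hpos : ∀ x ∈ Set.Icc (-(L / 2)) (L / 2), 0 ≤ profile L v x) :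
    v ⬝ᵥ v ≤ (2 * N + 1) * v 0 ^ 2 := by
  set S : ℝ := v ⬝ᵥ v with hSdef
  have hS0 : 0 ≤ S := dotProduct_self_nonneg v
  set c : ℝ := (2 * N + 1) / L with hcdef
  have hc0 : 0 ≤ c := by positivity
  set M : ℝ := Real.sqrt S * Real.sqrt c with hMdef
  have hM0 : 0 ≤ M := by positivity
  have hab : -(L / 2) ≤ L / 2 := by linarith
  -- pointwise: `0 ≤ θ ≤ M` on the window, hence `θ² ≤ M θ`
  have hbound : ∀ x, profile L v x ≤ M := by
    intro x
    have h := Real.abs_le_sqrt (profile_sq_le hL v x)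
    rw [Real.sqrt_mul hS0] at h
    exact (le_abs_self _).trans h
  have hpt : ∀ x ∈ Set.Icc (-(L / 2)) (L / 2), profile L v x ^ 2 ≤ M * profile L v x := by
    intro x hx
    rw [sq]
    exact mul_le_mul_of_nonneg_right (hbound x) (hpos x hx)
  -- integrate over the window
  have hint : ∫ x in (-(L / 2))..(L / 2), profile L v x ^ 2 ≤ ∫ x in (-(L / 2))..(L / 2), M * profile L v x := by
    refine intervalIntegral.integral_mono_on hab (Continuous.intervalIntegrable (by fun_prop) _ _)
      (Continuous.intervalIntegrable (by fun_prop) _ _) fun x hx => hpt x hx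
  rw [integral_profile_sq hL, intervalIntegral.integral_const_mul, integral_profile hL] at hint
  -- `hint : S ≤ M * (v 0 * √L)`; the mean is nonnegative
  have hmean : 0 ≤ v 0 * Real.sqrt L := by
    rw [← integral_profile hL v]
    exact intervalIntegral.integral_nonneg hab fun x hx => hpos x hx
  -- `√S · √S ≤ √S · (√c · v 0 · √L)`
  have hSS : Real.sqrt S * Real.sqrt S = S := Real.mul_self_sqrt hS0
  have key : Real.sqrt S * Real.sqrt S ≤ Real.sqrt S * (Real.sqrt c * (v 0 * Real.sqrt L)) := by
    rw [hSS]
    calc S ≤ M * (v 0 * Real.sqrt L) := hint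
      _ = Real.sqrt S * (Real.sqrt c * (v 0 * Real.sqrt L)) := by rw [hMdef]; ring
  by_cases hS : Real.sqrt S = 0
  · have : S = 0 := (Real.sqrt_eq_zero hS0).1 hS
    rw [this]; positivity
  · have hSpos : 0 < Real.sqrt S := lt_of_le_of_ne (Real.sqrt_nonneg S) (Ne.symm hS)
    have h1 : Real.sqrt S ≤ Real.sqrt c * (v 0 * Real.sqrt L) := le_of_mul_le_mul_left key hSpos
    have h2 : Real.sqrt S ^ 2 ≤ (Real.sqrt c * (v 0 * Real.sqrt L)) ^ 2 :=
      pow_le_pow_left₀ (Real.sqrt_nonneg S) h1 2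
    rw [Real.sq_sqrt hS0] at h2
    calc S ≤ (Real.sqrt c * (v 0 * Real.sqrt L)) ^ 2 := h2
      _ = Real.sqrt c ^ 2 * v 0 ^ 2 * Real.sqrt L ^ 2 := by ring
      _ = c * v 0 ^ 2 * L := by rw [Real.sq_sqrt hc0, Real.sq_sqrt hL.le]
      _ = (2 * N + 1) * v 0 ^ 2 := by rw [hcdef]; field_simp

/-- **PROVED — THE CENTRAL-MASS FLOOR (coefficient form).** If the profile `θ_v` is ONE-SIGNED on the window
`[-L/2, L/2]` (`0 < L`), then `v ⬝ᵥ v ≤ (2N+1) · (v 0)²`: at least the fraction `1/(2N+1)` of the `ℓ²`-mass of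
`v` sits on the constant mode `ξ₀`. (Kernel-lemma target `CentralMassFloor`, ADJ-LOG A5 (iii).) [folklore] -/
theorem dotProduct_self_le_of_oneSigned {L : ℝ} (hL : 0 < L) {N : ℕ} {v : Fin (N + 1) → ℝ}
    (hv : OneSigned L v) : v ⬝ᵥ v ≤ (2 * N + 1) * v 0 ^ 2 := by
  rcases hv with hpos | hneg
  · exact dotProduct_self_le_of_nonneg hL hpos
  · have hpos' : ∀ x ∈ Set.Icc (-(L / 2)) (L / 2), 0 ≤ profile L (-v) x := fun x hx => by
      rw [profile_neg]; linarith [hneg x hx]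
    have h := dotProduct_self_le_of_nonneg hL hpos'
    simpa using h

/-! ## 3. The central mass and its floor in the cell's units -/

/-- The CENTRAL MASS of a coefficient vector on the window of length `L` (`= 2a`):
`m(v) = |v 0| √L / √(v ⬝ᵥ v) = |∫ θ_v| / ‖θ_v‖_{L²}` (observatory: `|u_even[0]| √(2a)` for a unit bottom vector;
STRUCTURE-D3 `centralMass`, gap row S3-I6). Junk value `0` at `v = 0`. [folklore] -/
def centralMass (L : ℝ) {N : ℕ} (v : Fin (N + 1) → ℝ) : ℝ :=
  |v 0| * Real.sqrt L / Real.sqrt (v ⬝ᵥ v)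

/-- PROVED: `m(v) = |∫_{-L/2}^{L/2} θ_v| / (∫ θ_v²)^{1/2}` (`0 < L`) — the definition agrees with the profile reading.
[folklore] -/
theorem centralMass_eq_integral {L : ℝ} (hL : 0 < L) {N : ℕ} (v : Fin (N + 1) → ℝ) :
    centralMass L v = |∫ x in (-(L / 2))..(L / 2), profile L v x|
      / Real.sqrt (∫ x in (-(L / 2))..(L / 2), profile L v x ^ 2) := by
  rw [integral_profile hL, integral_profile_sq hL, centralMass, abs_mul, abs_of_nonneg (Real.sqrt_nonneg L)]

/-- **PROVED — THE CENTRAL-MASS FLOOR.** A non-zero coefficient vector with ONE-SIGNED profile on `[-L/2, L/2]`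
(`0 < L`) has central mass `m(v) ≥ √(L/(2N+1))`. [folklore] -/
theorem centralMass_floor {L : ℝ} (hL : 0 < L) {N : ℕ} {v : Fin (N + 1) → ℝ} (hv : OneSigned L v)
    (hv0 : v ≠ 0) : Real.sqrt (L / (2 * N + 1)) ≤ centralMass L v := by
  have hS : 0 < v ⬝ᵥ v :=
    lt_of_le_of_ne (dotProduct_self_nonneg v) fun h => hv0 (dotProduct_self_eq_zero.1 h.symm)
  have hfloor := dotProduct_self_le_of_oneSigned hL hv
  have hN : (0 : ℝ) < 2 * N + 1 := by positivity
  unfold centralMass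
  rw [le_div_iff₀ (Real.sqrt_pos.2 hS)]
  have hlhs : Real.sqrt (L / (2 * N + 1)) * Real.sqrt (v ⬝ᵥ v) = Real.sqrt (L / (2 * N + 1) * (v ⬝ᵥ v)) :=
    (Real.sqrt_mul (by positivity) _).symm
  have hrhs : |v 0| * Real.sqrt L = Real.sqrt (v 0 ^ 2 * L) := by
    rw [Real.sqrt_mul (sq_nonneg _), Real.sqrt_sq_eq_abs]
  rw [hlhs, hrhs]
  apply Real.sqrt_le_sqrt
  rw [div_mul_eq_mul_div, div_le_iff₀ hN]
  calc L * (v ⬝ᵥ v) ≤ L * ((2 * N + 1) * v 0 ^ 2) := mul_le_mul_of_nonneg_left hfloor hL.le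
    _ = v 0 ^ 2 * L * (2 * N + 1) := by ring

/-- **PROVED — the floor in half-width units (ADJ-LOG A5 (iii) verbatim: "one-signed on `(−a, a)` ⇒
`m ≥ √a/√(N+1)`").** With `L = 2a`, `0 < a`: `√a / √(N+1) ≤ m(v)` for every non-zero `v` whose profile is one-signed
on `[-a, a]` (weaker than `centralMass_floor` since `a/(N+1) ≤ 2a/(2N+1)`). [folklore] -/
theorem centralMass_floor_halfWidth {a : ℝ} (ha : 0 < a) {N : ℕ} {v : Fin (N + 1) → ℝ}
    (hv : OneSigned (2 * a) v) (hv0 : v ≠ 0) :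
    Real.sqrt a / Real.sqrt ((N : ℝ) + 1) ≤ centralMass (2 * a) v := by
  have h := centralMass_floor (by positivity : (0 : ℝ) < 2 * a) hv hv0
  refine le_trans ?_ h
  rw [← Real.sqrt_div ha.le]
  apply Real.sqrt_le_sqrt
  have hN1 : (0 : ℝ) < (N : ℝ) + 1 := by positivity
  have hN2 : (0 : ℝ) < 2 * N + 1 := by positivity
  rw [div_le_div_iff₀ hN1 hN2]
  nlinarith

/-- **PROVED — contrapositive (failure class F3, "small central mass forces a node").** A non-zero coefficient
vector whose central mass is below `√a/√(N+1)` is NOT one-signed on `[-a, a]`. [folklore] -/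
theorem not_oneSigned_of_centralMass_lt {a : ℝ} (ha : 0 < a) {N : ℕ} {v : Fin (N + 1) → ℝ} (hv0 : v ≠ 0)
    (hm : centralMass (2 * a) v < Real.sqrt a / Real.sqrt ((N : ℝ) + 1)) : ¬ OneSigned (2 * a) v :=
  fun hv => (not_le.2 hm) (centralMass_floor_halfWidth ha hv hv0)

/-- **PROVED — the floor at a served window.** For any datum `d` and genuine window `win` (`0 < win.a`), a
ONE-SIGNED bottom vector `u` of `d win` (the single-window criterion `oneSignedAt win`) has central mass
`≥ √(win.a)/√(win.N+1)`. [folklore] -/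
theorem centralMass_floor_of_isBottomVector (d : Datum) (win : Window) (ha : 0 < win.a)
    {u : Fin (win.N + 1) → ℝ} (hu : IsBottomVector (d win) u) (h1 : OneSigned (2 * win.a) u) :
    Real.sqrt win.a / Real.sqrt ((win.N : ℝ) + 1) ≤ centralMass (2 * win.a) u :=
  centralMass_floor_halfWidth ha h1 hu.1

end Summit.RiemannHypothesis.RiemannHypothesis.Theorems.PfPersistence.CentralMassFloor

end
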